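import Summits.QuantumFields.BalabanUV.Beta.GAN24.DirichletRingHessianLocal

/-!
# `BalabanUV.Beta.GAN24.DirichletRingHessianLocalShift` — binder row G-an2-4 / (CONV-C), road P2 PART IV, leaf L14 (the torus transfer),
# model brick C1′: THE LOCAL `H²` ESTIMATE WITH A WIDE PLATEAU (shifted smoothstep: plateau `Q_{2L+c}`, support `Q_{4L+c−1}`)
# (unit b2b-balaban-gan24-p2, gen 26, v1)

HONEST FRAMING (cell contract, verbatim): «discharging `BetaPertH` makes Bałaban's UV stability UNCONDITIONAL — a real constructive-QFT
result; it is NOT the continuum limit and NOT the Clay problem.»  SUPPLIER brick under the T⁴-DAG sub-row `T4-U1a.S-NE2-D1-DIRICHLET°`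
(owner wording R24 «the full rate L⁻¹ beyond boxes OPEN»), MODEL coordinates.  `DirichletRingHessianLocal.local_hessian_le` (p244602)
concludes on `Q_{2L−1}` from hypotheses on `Q_{4L+1}` (plateau/support ratio 1:2 of `bump L`).  The vertex census of (A) on the torus needs
ONE window per block vertex that (i) fits in the chart window `Q_n` and (ii) reaches ring radius `⌈n/2⌉ + 1` (every site of a block is
within that ring distance of the nearest corner).  This file supplies the cut-off with an ARBITRARY plateau: `etaS L c i = prof L (tIdx i − c)`
(`= 0` for `tIdx ≤ 2L + c`, `= 1` for `tIdx ≥ 4L + c`, `|δ| ≤ 1/L`, `|δ²| ≤ 1/L²` — the kink of `tIdx` at `0` is invisible because `prof L`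
vanishes below `2L ≥ 2`), `bumpS L c = (1 − etaS L c i)(1 − etaS L c j)`, and **`local_hessian_le_shift`**: for `W` axis-separated, `U = 0`
off `W` on `Q_{4L+c}`, `lap U = G` on `Q_{4L+c+1} ∩ W`:
`Σ_{Q_{2L+c−1}} 𝟙_W·(|∂₁²U|² + |∂₂²U|²) ≤ 2·Σ_{Q_{4L+c+1}} 𝟙_W·|G|² + (32/L²)·Ẽ_{4L+c+1} + (16/L⁴)·Σ_{Q_{4L+c+1}}|U|²`
(with `L = ⌊n/16⌋`, `c = n − 1 − 4L` the window is `Q_n` and the conclusion covers `Q_{n−2−2L} ⊇ Q_{⌈n/2⌉+1}` for `n ≥ 16`).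

ABSOLUTE RULE (cell, verbatim): «No internally-minted statement may enter as a cited fact. Every hypothesis is either kernel-proved in
this package or a verbatim quotation of a PUBLISHED theorem with page reference. The manuscript(s) under audit are NOT citable for
their own disputed steps — they are the thing under adjudication; programme-internal (2001/route/tribunal) claims are never citable.»
[folklore]; nothing printed is a hypothesis.  NOT CLAIMED: (A) on the torus, NE2, (CONV-C), `BetaPertH`, continuum, Clay.  «not in print;
our proof attempt».  HONEST DEPENDENCY: continuum YM on T⁴ ⇐ BetaPertH ∧ nine spine estimates (0/9 proved); BetaPertH ⇐ (D1) ∧ (D4) ∧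
CAP+tail; G-an2-4 gates asym, D1 and NE2/3/4.
-/

noncomputable section

open scoped BigOperators ComplexConjugate
open Finset

namespace Summit.QuantumFields.BalabanUV.Beta.GAN24.DirichletRingHessianLocalShift

open DirichletRingEnergies (lap sqSum Et Et_nonneg sqSum_nonneg)
open DirichletRingCutoff (prof prof_of_le_two prof_of_ge_four prof_mem abs_prof_sub_le abs_prof_dd_le tIdx one_le_tIdx norm_commutator_sq_le)
open DirichletRingHessianIdentity (d1 d2 boxSum)
open DirichletRingHessianWindow (rho nbr nbr_sqSum_le sqSum_le_of_le tIdx_step)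
open DirichletRingLayerCake (sqSum_eq_of_vanish)
open DirichletRingHessianLocal (AxisSep indW indW_mem axis_cond_of_supp hessian_le_of_axis)

/-! ## §1 The shifted profile along a lattice line -/

/-- the shifted profile: `etaS L c i = prof L (tIdx i − c)`. [folklore] -/
def etaS (L c : ℕ) (i : ℤ) : ℝ := prof L (tIdx i - c)

variable {L c : ℕ}

/-- `0 ≤ etaS ≤ 1`. [folklore] -/
theorem etaS_mem (hL : 1 ≤ L) (i : ℤ) : 0 ≤ etaS L c i ∧ etaS L c i ≤ 1 := prof_mem hL _

/-- `etaS = 0` on `tIdx ≤ 2L + c`. [folklore] -/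
theorem etaS_eq_zero {i : ℤ} (h : tIdx i ≤ 2 * (L : ℤ) + c) : etaS L c i = 0 := prof_of_le_two (by unfold tIdx at *; omega)

/-- `etaS = 1` on `4L + c ≤ tIdx`. [folklore] -/
theorem etaS_eq_one (hL : 1 ≤ L) {i : ℤ} (h : 4 * (L : ℤ) + c ≤ tIdx i) : etaS L c i = 1 := prof_of_ge_four hL (by omega)

/-- **first differences**: `|etaS(i+1) − etaS(i)| ≤ 1/L`. [folklore] -/
theorem abs_etaS_sub_le (hL : 1 ≤ L) (i : ℤ) : |etaS L c (i + 1) - etaS L c i| ≤ 1 / (L : ℝ) := by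
  have hL0 : (0 : ℝ) < L := by exact_mod_cast hL
  rcases le_or_gt 0 i with hi | hi
  · have e1 : tIdx (i + 1) - (c : ℤ) = (i + 1 - c) + 1 := by unfold tIdx; rw [if_pos (by omega)]; ring
    have e2 : tIdx i - (c : ℤ) = i + 1 - c := by unfold tIdx; rw [if_pos hi]
    unfold etaS; rw [e1, e2]; exact abs_prof_sub_le hL _
  rcases le_or_gt i (-2) with hi' | hi'
  · have e1 : tIdx (i + 1) - (c : ℤ) = -i - 1 - c := by unfold tIdx; rw [if_neg (by omega)]; ring
    have e2 : tIdx i - (c : ℤ) = (-i - 1 - c) + 1 := by unfold tIdx; rw [if_neg (by omega)]; ring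
    unfold etaS; rw [e1, e2, abs_sub_comm]; exact abs_prof_sub_le hL _
  · have hi1 : i = -1 := by omega
    subst hi1
    have e1 : tIdx (-1 + 1) = 1 := by unfold tIdx; rw [if_pos (by omega)]; ring
    have e2 : tIdx (-1) = 1 := by unfold tIdx; rw [if_neg (by omega)]; ring
    unfold etaS; rw [e1, e2, sub_self, abs_zero]; positivity

/-- **second differences**: `|etaS(i+1) − 2etaS(i) + etaS(i−1)| ≤ 1/L²`. [folklore] -/
theorem abs_etaS_dd_le (hL : 1 ≤ L) (i : ℤ) : |etaS L c (i + 1) - 2 * etaS L c i + etaS L c (i - 1)| ≤ 1 / (L : ℝ) ^ 2 := by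
  have hL0 : (0 : ℝ) < L := by exact_mod_cast hL
  have hpos : 0 ≤ 1 / (L : ℝ) ^ 2 := by positivity
  rcases le_or_gt 1 i with hi | hi
  · have e1 : tIdx (i + 1) - (c : ℤ) = (i + 1 - c) + 1 := by unfold tIdx; rw [if_pos (by omega)]; ring
    have e2 : tIdx i - (c : ℤ) = i + 1 - c := by unfold tIdx; rw [if_pos (by omega)]
    have e3 : tIdx (i - 1) - (c : ℤ) = (i + 1 - c) - 1 := by unfold tIdx; rw [if_pos (by omega)]; ring
    unfold etaS; rw [e1, e2, e3]; exact abs_prof_dd_le hL _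
  rcases le_or_gt i (-2) with hi' | hi'
  · have e1 : tIdx (i + 1) - (c : ℤ) = (-i - c) - 1 := by unfold tIdx; rw [if_neg (by omega)]; ring
    have e2 : tIdx i - (c : ℤ) = -i - c := by unfold tIdx; rw [if_neg (by omega)]
    have e3 : tIdx (i - 1) - (c : ℤ) = (-i - c) + 1 := by unfold tIdx; rw [if_neg (by omega)]; ring
    unfold etaS; rw [e1, e2, e3]
    have h := abs_prof_dd_le hL (-i - c)
    have e : prof L (-i - ↑c - 1) - 2 * prof L (-i - ↑c) + prof L (-i - ↑c + 1)
        = prof L (-i - ↑c + 1) - 2 * prof L (-i - ↑c) + prof L (-i - ↑c - 1) := by ring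
    rw [e]; exact h
  · -- i ∈ {−1, 0}: all three shifted half-indices are ≤ 2 ≤ 2L
    have h1 : tIdx (i + 1) - (c : ℤ) ≤ 2 * (L : ℤ) := by unfold tIdx; split_ifs <;> omega
    have h2 : tIdx i - (c : ℤ) ≤ 2 * (L : ℤ) := by unfold tIdx; split_ifs <;> omega
    have h3 : tIdx (i - 1) - (c : ℤ) ≤ 2 * (L : ℤ) := by unfold tIdx; split_ifs <;> omega
    unfold etaS
    rw [prof_of_le_two h1, prof_of_le_two h2, prof_of_le_two h3]
    norm_num [hpos]

/-! ## §2 The wide-plateau cut-off -/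

/-- the wide-plateau cut-off: `bumpS L c i j = (1 − etaS L c i)(1 − etaS L c j)`. [folklore] -/
def bumpS (L c : ℕ) (i j : ℤ) : ℝ := (1 - etaS L c i) * (1 - etaS L c j)

/-- `0 ≤ bumpS ≤ 1`. [folklore] -/
theorem bumpS_mem (hL : 1 ≤ L) (i j : ℤ) : 0 ≤ bumpS L c i j ∧ bumpS L c i j ≤ 1 := by
  obtain ⟨a0, a1⟩ := etaS_mem (c := c) hL i
  obtain ⟨b0, b1⟩ := etaS_mem (c := c) hL j
  unfold bumpS
  constructor
  · exact mul_nonneg (by linarith) (by linarith)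
  · calc (1 - etaS L c i) * (1 - etaS L c j) ≤ 1 * 1 := mul_le_mul (by linarith) (by linarith) (by linarith) zero_le_one
      _ = 1 := one_mul 1

/-- `bumpS = 1` on `Q_{2L+c}`. [folklore] -/
theorem bumpS_eq_one {i j : ℤ} (hi : tIdx i ≤ 2 * (L : ℤ) + c) (hj : tIdx j ≤ 2 * (L : ℤ) + c) : bumpS L c i j = 1 := by
  rw [bumpS, etaS_eq_zero hi, etaS_eq_zero hj]; ring

/-- `bumpS = 0` off `Q_{4L+c−1}`. [folklore] -/
theorem bumpS_eq_zero (hL : 1 ≤ L) {i j : ℤ} (h : 4 * (L : ℤ) + c ≤ tIdx i ∨ 4 * (L : ℤ) + c ≤ tIdx j) : bumpS L c i j = 0 := by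
  rcases h with h | h
  · rw [bumpS, etaS_eq_one hL h]; ring
  · rw [bumpS, etaS_eq_one hL h]; ring

/-- `|δ₁ bumpS| ≤ 1/L` (both orientations), `|δ₂ bumpS| ≤ 1/L`, `|δ₁² bumpS|, |δ₂² bumpS| ≤ 1/L²`. [folklore] -/
theorem bumpS_bounds (hL : 1 ≤ L) (i j : ℤ) :
    |bumpS L c (i + 1) j - bumpS L c i j| ≤ 1 / (L : ℝ) ∧ |bumpS L c (i - 1) j - bumpS L c i j| ≤ 1 / (L : ℝ)
      ∧ |bumpS L c i (j + 1) - bumpS L c i j| ≤ 1 / (L : ℝ) ∧ |bumpS L c i (j - 1) - bumpS L c i j| ≤ 1 / (L : ℝ)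
      ∧ |bumpS L c (i + 1) j - 2 * bumpS L c i j + bumpS L c (i - 1) j| ≤ 1 / (L : ℝ) ^ 2
      ∧ |bumpS L c i (j + 1) - 2 * bumpS L c i j + bumpS L c i (j - 1)| ≤ 1 / (L : ℝ) ^ 2 := by
  obtain ⟨a0, a1⟩ := etaS_mem (c := c) hL i
  obtain ⟨b0, b1⟩ := etaS_mem (c := c) hL j
  have hgi : |1 - etaS L c i| ≤ 1 := by rw [abs_le]; constructor <;> linarith
  have hgj : |1 - etaS L c j| ≤ 1 := by rw [abs_le]; constructor <;> linarith
  have k1 : ∀ i' : ℤ, |bumpS L c (i' + 1) j - bumpS L c i' j| ≤ 1 / (L : ℝ) := by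
    intro i'
    have e : bumpS L c (i' + 1) j - bumpS L c i' j = -(etaS L c (i' + 1) - etaS L c i') * (1 - etaS L c j) := by unfold bumpS; ring
    rw [e, abs_mul, abs_neg]
    calc _ ≤ 1 / (L : ℝ) * 1 := mul_le_mul (abs_etaS_sub_le hL i') hgj (abs_nonneg _) (by positivity)
      _ = _ := mul_one _
  have k2 : ∀ j' : ℤ, |bumpS L c i (j' + 1) - bumpS L c i j'| ≤ 1 / (L : ℝ) := by
    intro j'
    have e : bumpS L c i (j' + 1) - bumpS L c i j' = (1 - etaS L c i) * -(etaS L c (j' + 1) - etaS L c j') := by unfold bumpS; ring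
    rw [e, abs_mul, abs_neg]
    calc _ ≤ 1 * (1 / (L : ℝ)) := mul_le_mul hgi (abs_etaS_sub_le hL j') (abs_nonneg _) zero_le_one
      _ = _ := one_mul _
  refine ⟨k1 i, ?_, k2 j, ?_, ?_, ?_⟩
  · have h := k1 (i - 1); rwa [sub_add_cancel, abs_sub_comm] at h
  · have h := k2 (j - 1); rwa [sub_add_cancel, abs_sub_comm] at h
  · have e : bumpS L c (i + 1) j - 2 * bumpS L c i j + bumpS L c (i - 1) j
        = -(etaS L c (i + 1) - 2 * etaS L c i + etaS L c (i - 1)) * (1 - etaS L c j) := by unfold bumpS; ring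
    rw [e, abs_mul, abs_neg]
    calc _ ≤ 1 / (L : ℝ) ^ 2 * 1 := mul_le_mul (abs_etaS_dd_le hL i) hgj (abs_nonneg _) (by positivity)
      _ = _ := mul_one _
  · have e : bumpS L c i (j + 1) - 2 * bumpS L c i j + bumpS L c i (j - 1)
        = (1 - etaS L c i) * -(etaS L c (j + 1) - 2 * etaS L c j + etaS L c (j - 1)) := by unfold bumpS; ring
    rw [e, abs_mul, abs_neg]
    calc _ ≤ 1 * (1 / (L : ℝ) ^ 2) := mul_le_mul hgi (abs_etaS_dd_le hL j) (abs_nonneg _) zero_le_one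
      _ = _ := one_mul _

/-! ## §3 The local `H²` estimate with a wide plateau -/

section Local

variable (W : ℤ → ℤ → Prop) [∀ i j, Decidable (W i j)] (U : ℤ → ℤ → ℂ)

/-- **THE LOCAL `H²` ESTIMATE, wide plateau** (model, lattice units): for `1 ≤ L`, `W` axis-separated, `U = 0` off `W` on `Q_{4L+c}`
and `lap U = G` on `Q_{4L+c+1} ∩ W`:
`Σ_{Q_{2L+c−1}} 𝟙_W·(|∂₁²U|² + |∂₂²U|²) ≤ 2·Σ_{Q_{4L+c+1}} 𝟙_W·|G|² + (32/L²)·Ẽ_{4L+c+1} + (16/L⁴)·Σ_{Q_{4L+c+1}}|U|²`. [folklore] -/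
theorem local_hessian_le_shift (hL : 1 ≤ L) (hW : AxisSep W) (G : ℤ → ℤ → ℂ)
    (hUW : ∀ i j : ℤ, tIdx i ≤ 4 * (L : ℤ) + c → tIdx j ≤ 4 * (L : ℤ) + c → ¬ W i j → U i j = 0)
    (hEq : ∀ i j : ℤ, tIdx i ≤ 4 * (L : ℤ) + c + 1 → tIdx j ≤ 4 * (L : ℤ) + c + 1 → W i j → lap U i j = G i j) :
    sqSum (fun i j => indW W i j * (‖d1 U i j‖ ^ 2 + ‖d2 U i j‖ ^ 2)) (2 * L + c - 1)
      ≤ 2 * sqSum (fun i j => indW W i j * ‖G i j‖ ^ 2) (4 * L + c + 1)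
        + 32 / (L : ℝ) ^ 2 * Et U (4 * L + c + 1) + 16 / (L : ℝ) ^ 4 * sqSum (fun i j => ‖U i j‖ ^ 2) (4 * L + c + 1) := by
  set K : ℕ := 4 * L + c + 1 with hK
  have hK1 : 1 ≤ K := by omega
  have hL0 : (0 : ℝ) < L := by exact_mod_cast hL
  set z : ℤ → ℤ → ℂ := fun i j => (bumpS L c i j : ℂ) * U i j with hz
  have hzW : ∀ i j, ¬ W i j → z i j = 0 := by
    intro i j h
    by_cases hb : 4 * (L : ℤ) + c ≤ tIdx i ∨ 4 * (L : ℤ) + c ≤ tIdx j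
    · simp only [hz, bumpS_eq_zero hL hb, Complex.ofReal_zero, zero_mul]
    · simp only [not_or, not_le] at hb
      simp only [hz, hUW i j (by omega) (by omega) h, mul_zero]
  have hzout : ∀ i j : ℤ, (i < -(K : ℤ) + 2 ∨ -(K : ℤ) + ((2 * K - 1 : ℕ) : ℤ) - 1 ≤ i ∨ j < -(K : ℤ) + 2 ∨ -(K : ℤ) + ((2 * K - 1 : ℕ) : ℤ) - 1 ≤ j)
      → z i j = 0 := by
    intro i j h
    have hNz : ((2 * K - 1 : ℕ) : ℤ) = 2 * (K : ℤ) - 1 := by omega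
    rw [hNz] at h
    have hout : 4 * (L : ℤ) + c ≤ tIdx i ∨ 4 * (L : ℤ) + c ≤ tIdx j := by
      unfold tIdx; split_ifs <;> omega
    simp only [hz, bumpS_eq_zero hL hout, Complex.ofReal_zero, zero_mul]
  have hH := hessian_le_of_axis z (indW W) (-(K : ℤ)) (2 * K - 1) hzout (axis_cond_of_supp W hW hzW)
  have e2K : 2 * K - 1 + 1 = 2 * K := by omega
  rw [e2K] at hH
  change sqSum (fun i j => indW W i j * (‖d1 z i j‖ ^ 2 + ‖d2 z i j‖ ^ 2)) K
    ≤ sqSum (fun i j => indW W i j * ‖lap z i j‖ ^ 2) K at hH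
  -- (1) on `Q_{2L+c−1}` the second differences of `z` are those of `U`
  have hplateau : sqSum (fun i j => indW W i j * (‖d1 U i j‖ ^ 2 + ‖d2 U i j‖ ^ 2)) (2 * L + c - 1)
      ≤ sqSum (fun i j => indW W i j * (‖d1 z i j‖ ^ 2 + ‖d2 z i j‖ ^ 2)) K := by
    set f : ℤ → ℤ → ℝ := fun i j =>
      if tIdx i ≤ 2 * (L : ℤ) + c - 1 ∧ tIdx j ≤ 2 * (L : ℤ) + c - 1 then indW W i j * (‖d1 U i j‖ ^ 2 + ‖d2 U i j‖ ^ 2) else 0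
      with hf
    have hfv : sqSum f K = sqSum f (2 * L + c - 1) :=
      sqSum_eq_of_vanish f (by omega) fun i j h => by
        rw [hf]; simp only
        rw [if_neg]
        push_cast [Nat.cast_sub (by omega : 1 ≤ 2 * L + c)] at h ⊢
        omega
    have hf1 : sqSum (fun i j => indW W i j * (‖d1 U i j‖ ^ 2 + ‖d2 U i j‖ ^ 2)) (2 * L + c - 1) = sqSum f (2 * L + c - 1) := by
      refine sum_congr rfl fun t ht => sum_congr rfl fun s hs => ?_
      have ht' := mem_range.mp ht
      have hs' := mem_range.mp hs
      rw [hf]; simp only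
      rw [if_pos]
      constructor <;> (unfold tIdx; split_ifs <;> push_cast [Nat.cast_sub (by omega : 1 ≤ 2 * L + c)] <;> omega)
    rw [hf1, ← hfv]
    refine sqSum_le_of_le (fun i j => ?_) K
    rw [hf]; simp only
    split_ifs with hp
    · refine le_of_eq ?_
      obtain ⟨t1, t2, t3, t4⟩ := tIdx_step i
      obtain ⟨s1, s2, s3, s4⟩ := tIdx_step j
      have c0 : bumpS L c i j = 1 := bumpS_eq_one (by omega) (by omega)
      have c1 : bumpS L c (i + 1) j = 1 := bumpS_eq_one (by omega) (by omega)
      have c2 : bumpS L c (i - 1) j = 1 := bumpS_eq_one (by omega) (by omega)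
      have c3 : bumpS L c i (j + 1) = 1 := bumpS_eq_one (by omega) (by omega)
      have c4 : bumpS L c i (j - 1) = 1 := bumpS_eq_one (by omega) (by omega)
      simp only [hz, d1, d2, c0, c1, c2, c3, c4, Complex.ofReal_one, one_mul]
    · exact mul_nonneg (indW_mem W i j).1 (add_nonneg (sq_nonneg _) (sq_nonneg _))
  -- (2) on `W`: `|Δz|² ≤ 2|G|² + 2|comm|²`
  set comm : ℤ → ℤ → ℂ := fun i j => lap z i j - (bumpS L c i j : ℂ) * lap U i j with hcomm
  have hrhs : sqSum (fun i j => indW W i j * ‖lap z i j‖ ^ 2) K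
      ≤ sqSum (fun i j => 2 * (indW W i j * ‖G i j‖ ^ 2) + 2 * ‖comm i j‖ ^ 2) K := by
    refine sum_le_sum fun t ht => sum_le_sum fun s hs => ?_
    have ht' := mem_range.mp ht
    have hs' := mem_range.mp hs
    show indW W (-(K : ℤ) + s) (-(K : ℤ) + t) * ‖lap z (-(K : ℤ) + s) (-(K : ℤ) + t)‖ ^ 2
      ≤ 2 * (indW W (-(K : ℤ) + s) (-(K : ℤ) + t) * ‖G (-(K : ℤ) + s) (-(K : ℤ) + t)‖ ^ 2) + 2 * ‖comm (-(K : ℤ) + s) (-(K : ℤ) + t)‖ ^ 2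
    unfold indW
    split_ifs with hq
    · rw [one_mul, one_mul]
      have hG : lap U (-(K : ℤ) + s) (-(K : ℤ) + t) = G (-(K : ℤ) + s) (-(K : ℤ) + t) :=
        hEq _ _ (by unfold tIdx; split_ifs <;> omega) (by unfold tIdx; split_ifs <;> omega) hq
      have hdec : lap z (-(K : ℤ) + s) (-(K : ℤ) + t)
          = (bumpS L c (-(K : ℤ) + s) (-(K : ℤ) + t) : ℂ) * G (-(K : ℤ) + s) (-(K : ℤ) + t) + comm (-(K : ℤ) + s) (-(K : ℤ) + t) := by
        simp only [hcomm, hG]; ring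
      rw [hdec]
      obtain ⟨c0, c1⟩ := bumpS_mem (c := c) hL (-(K : ℤ) + s) (-(K : ℤ) + t)
      set a := (bumpS L c (-(K : ℤ) + s) (-(K : ℤ) + t) : ℂ) * G (-(K : ℤ) + s) (-(K : ℤ) + t) with ha
      set b := comm (-(K : ℤ) + s) (-(K : ℤ) + t) with hb'
      have hn1 : ‖a‖ ≤ ‖G (-(K : ℤ) + s) (-(K : ℤ) + t)‖ := by
        rw [ha, norm_mul, Complex.norm_real, Real.norm_eq_abs, abs_of_nonneg c0]
        exact mul_le_of_le_one_left (norm_nonneg _) c1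
      have hadd := norm_add_le a b
      have h0 := norm_nonneg (a + b)
      have hsq : ‖a + b‖ ^ 2 ≤ (‖a‖ + ‖b‖) ^ 2 := pow_le_pow_left₀ h0 hadd 2
      nlinarith [norm_nonneg b, norm_nonneg a, norm_nonneg (G (-(K : ℤ) + s) (-(K : ℤ) + t)), sq_nonneg (‖a‖ - ‖b‖), hn1]
    · rw [zero_mul, zero_mul, mul_zero, zero_add]; positivity
  -- (3) the commutator
  have hcpt : ∀ i j, ‖comm i j‖ ^ 2 ≤ 8 * (1 / (L : ℝ)) ^ 2 * nbr U i j + 8 * (1 / (L : ℝ) ^ 2) ^ 2 * ‖U i j‖ ^ 2 := by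
    intro i j
    obtain ⟨h1, h2, h3, h4, h5, h6⟩ := bumpS_bounds (c := c) hL i j
    have h := norm_commutator_sq_le (bumpS L c) U i j h1 h2 h3 h4 h5 h6
    simp only [hcomm, hz, nbr]
    exact h
  have hcsum : sqSum (fun i j => ‖comm i j‖ ^ 2) K ≤ 8 / (L : ℝ) ^ 2 * (2 * Et U K) + 8 / (L : ℝ) ^ 4 * sqSum (fun i j => ‖U i j‖ ^ 2) K := by
    have h1 : sqSum (fun i j => ‖comm i j‖ ^ 2) K
        ≤ sqSum (fun i j => 8 * (1 / (L : ℝ)) ^ 2 * nbr U i j + 8 * (1 / (L : ℝ) ^ 2) ^ 2 * ‖U i j‖ ^ 2) K := sqSum_le_of_le hcpt K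
    have h2 : sqSum (fun i j => 8 * (1 / (L : ℝ)) ^ 2 * nbr U i j + 8 * (1 / (L : ℝ) ^ 2) ^ 2 * ‖U i j‖ ^ 2) K
        = 8 * (1 / (L : ℝ)) ^ 2 * sqSum (nbr U) K + 8 * (1 / (L : ℝ) ^ 2) ^ 2 * sqSum (fun i j => ‖U i j‖ ^ 2) K := by
      simp only [sqSum, sum_add_distrib, mul_sum]
    rw [h2] at h1
    have e1 : 8 * (1 / (L : ℝ)) ^ 2 = 8 / (L : ℝ) ^ 2 := by ring
    have e2 : 8 * (1 / (L : ℝ) ^ 2) ^ 2 = 8 / (L : ℝ) ^ 4 := by ring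
    rw [e1, e2] at h1
    refine h1.trans (add_le_add ?_ le_rfl)
    exact mul_le_mul_of_nonneg_left (nbr_sqSum_le U hK1) (by positivity)
  have hsplit2 : sqSum (fun i j => 2 * (indW W i j * ‖G i j‖ ^ 2) + 2 * ‖comm i j‖ ^ 2) K
      = 2 * sqSum (fun i j => indW W i j * ‖G i j‖ ^ 2) K + 2 * sqSum (fun i j => ‖comm i j‖ ^ 2) K := by
    simp only [sqSum, sum_add_distrib, mul_sum]
  have hEt0 : 0 ≤ Et U K := Et_nonneg U K
  calc sqSum (fun i j => indW W i j * (‖d1 U i j‖ ^ 2 + ‖d2 U i j‖ ^ 2)) (2 * L + c - 1)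
      ≤ sqSum (fun i j => indW W i j * (‖d1 z i j‖ ^ 2 + ‖d2 z i j‖ ^ 2)) K := hplateau
    _ ≤ sqSum (fun i j => indW W i j * ‖lap z i j‖ ^ 2) K := hH
    _ ≤ 2 * sqSum (fun i j => indW W i j * ‖G i j‖ ^ 2) K + 2 * sqSum (fun i j => ‖comm i j‖ ^ 2) K := by rw [← hsplit2]; exact hrhs
    _ ≤ 2 * sqSum (fun i j => indW W i j * ‖G i j‖ ^ 2) K
        + 2 * (8 / (L : ℝ) ^ 2 * (2 * Et U K) + 8 / (L : ℝ) ^ 4 * sqSum (fun i j => ‖U i j‖ ^ 2) K) := by linarith [hcsum]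
    _ = _ := by ring

end Local

end Summit.QuantumFields.BalabanUV.Beta.GAN24.DirichletRingHessianLocalShift

end
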